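import Mathlib
import HarnessLib
import Literature.Probability.LatticeModels.LatticeGraph
import Summits.HubbardSuperconductivity.HubbardSuperconductivity.Theorems.BalabanIRBirComplexStableXYFixedVolumeTorus
import Summits.HubbardSuperconductivity.HubbardSuperconductivity.Theorems.BalabanIRBirComplexStableXYFixedVolumeExpansion
import Summits.HubbardSuperconductivity.HubbardSuperconductivity.Theorems.BalabanIRBirComplexStableXYFixedVolumeAction
import Summits.HubbardSuperconductivity.HubbardSuperconductivity.Theorems.BalabanIRBirComplexStableXYFixedVolumeLattice

/-!
# BalabanIR engine `BirComplexStableXY` (stmt-HubbardSuperconductivity-2080): fixed-volume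
analysis — from the typed cube to the sheared cube, and the coercive lower bound

Support lemmas for crux 2 of route BalabanIR (`--supports stmt-HubbardSuperconductivity-2080`),
penultimate file of the fixed-volume Laplace analysis (assembly in
`BalabanIRBirComplexStableXYFixedVolume.lean`):

* `birFixedVolume_cube_to_shear`: `∫_{[0,2π]^ι} Φ = 2π ∫_{(-π,π]^{ι∖s₀}} Φ (ext δ) dδ` for a
  continuous, `2π`-periodic, rotation-invariant `Φ` (faces null + cube independence + the
  one-spin shear of `…FixedVolumeTorus`);
* `birFixedVolume_re_action_coercive`: under (C) (`r ≥ 2`, `c₀ > 0`) there is `m > 0` with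
  `m Σ_j δ_j² ≤ Re Σ_s F (ext δ ∘ sh s)` on the closed cube `[-π, π]^{Λ∖s₀}` (coercive comparison
  of `…FixedVolumeLattice`, Jordan bound, connectivity, and the compactness lemmas of
  `…FixedVolumeExpansion`).

No definitions.
-/

namespace Summit.HubbardSuperconductivity.HubbardSuperconductivity.Theorems

open scoped BigOperators
open MeasureTheory Set Complex Filter Topology Literature.Probability.LatticeModels

section FixedVolume

variable {r : ℕ} {L M : ℕ} [NeZero L] [NeZero M]

/-- From the typed cube `[0,2π]^Λ` to the sheared half-open cube `(-π,π]^{Λ∖s₀}`. -/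
theorem birFixedVolume_cube_to_shear {ι : Type*} [Fintype ι] [DecidableEq ι] (s₀ : ι)
    {Φ : (ι → ℝ) → ℂ} (hΦ : Continuous Φ)
    (hper : ∀ (θ : ι → ℝ) (k : ι → ℤ), Φ (fun i => θ i + k i • (2 * Real.pi)) = Φ θ)
    (hrot : ∀ (θ : ι → ℝ) (α : ℝ), Φ (fun i => θ i + α) = Φ θ) :
    ∫ θ in Set.pi univ (fun _ : ι => Icc (0 : ℝ) (2 * Real.pi)), Φ θ
      = ((2 * Real.pi : ℝ) : ℂ) * ∫ δ in Set.pi univ (fun _ : {i // i ≠ s₀} => Ioc (-Real.pi) Real.pi),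
          Φ (fun i => if h : i = s₀ then 0 else δ ⟨i, h⟩) := by
  haveI : Fact (0 < 2 * Real.pi) := ⟨Real.two_pi_pos⟩
  have h1 : (Set.pi univ fun _ : ι => Icc (0 : ℝ) (2 * Real.pi))
      = Set.pi univ fun _ : ι => Icc (0 : ℝ) (0 + 2 * Real.pi) := by
    simp only [zero_add]
  have h2 : (Set.pi univ fun _ : {i // i ≠ s₀} => Ioc (-Real.pi) Real.pi)
      = Set.pi univ fun _ : {i // i ≠ s₀} => Ioc (-Real.pi) (-Real.pi + 2 * Real.pi) := by
    have : -Real.pi + 2 * Real.pi = Real.pi := by ring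
    simp only [this]
  rw [h1, h2, birTorus_setIntegral_Icc_eq_Ioc (p := 2 * Real.pi) 0 Φ,
    birTorus_setIntegral_indep 0 (-Real.pi) hΦ hper, birTorus_shear s₀ (-Real.pi) hΦ hper hrot]

omit [NeZero L] [NeZero M] in
/-- The extension by zero is linear. -/
theorem birFixedVolume_ext_smul (s₀ : TorusSite 2 L × ZMod M) (t : ℝ)
    (δ : {i // i ≠ s₀} → ℝ) (i : TorusSite 2 L × ZMod M) :
    (if h : i = s₀ then (0 : ℝ) else (t • δ) ⟨i, h⟩)
      = t * (if h : i = s₀ then (0 : ℝ) else δ ⟨i, h⟩) := by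
  by_cases h : i = s₀
  · simp [h]
  · simp [h]

omit [NeZero L] [NeZero M] in
/-- The extension by zero of a vector in a ball stays in the ball. -/
theorem birFixedVolume_abs_ext_le (s₀ : TorusSite 2 L × ZMod M) {ρ : ℝ} (hρ : 0 ≤ ρ)
    (δ : {i // i ≠ s₀} → ℝ) (hδ : ∀ j, |δ j| ≤ ρ) (i : TorusSite 2 L × ZMod M) :
    |(if h : i = s₀ then (0 : ℝ) else δ ⟨i, h⟩)| ≤ ρ := by
  by_cases h : i = s₀
  · simp [h, hρ]
  · simp only [h, dif_neg, not_false_eq_true]; exact hδ _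

/-- **Coercive lower bound for the real part of the sheared action.**  Under (C) (`r ≥ 2`,
`c₀ > 0`) there is `m > 0` with `m Σ_j δ_j² ≤ Re Σ_s F (ext δ ∘ sh s)` on the closed cube
`[-π, π]^{Λ∖s₀}`. -/
theorem birFixedVolume_re_action_coercive (hr : 2 ≤ r) {c₀ : ℝ} (hc₀ : 0 < c₀)
    (c : ((Fin r × Fin r × Fin r) → ℤ) →₀ ℂ)
    {F : ((Fin r × Fin r × Fin r) → ℝ) → ℂ}
    (hF : ∀ φ, F φ = c.sum (fun n a => a * cexp (I * ((∑ w, (n w : ℝ) * φ w : ℝ) : ℂ))))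
    (hC : ∀ φ : (Fin r × Fin r × Fin r) → ℝ,
      c₀ * ∑ w, ∑ w', (1 - Real.cos (φ w - φ w')) ≤ (F φ).re)
    {sh : (TorusSite 2 L × ZMod M) → (Fin r × Fin r × Fin r) → (TorusSite 2 L × ZMod M)}
    (hsh : ∀ s w, sh s w = (s.1 + ![((w.1 : ℕ) : ZMod L), ((w.2.1 : ℕ) : ZMod L)],
      s.2 + ((w.2.2 : ℕ) : ZMod M)))
    (s₀ : TorusSite 2 L × ZMod M) :
    ∃ m : ℝ, 0 < m ∧ ∀ δ ∈ Set.pi univ (fun _ : {i // i ≠ s₀} => Icc (-Real.pi) Real.pi),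
      m * ∑ j, δ j ^ 2
        ≤ (∑ s, F (fun w => (fun i => if h : i = s₀ then (0 : ℝ) else δ ⟨i, h⟩) (sh s w))).re := by
  set ext : ({i // i ≠ s₀} → ℝ) → (TorusSite 2 L × ZMod M) → ℝ :=
    fun δ i => if h : i = s₀ then (0 : ℝ) else δ ⟨i, h⟩ with hext
  have hext_c : Continuous ext := birTorus_continuous_ext s₀
  have hext_ci : ∀ i, Continuous fun δ : {i // i ≠ s₀} → ℝ => ext δ i :=
    fun i => (continuous_apply i).comp hext_c
  set P : ({i // i ≠ s₀} → ℝ) → ℝ := fun δ => (∑ s, F (fun w => ext δ (sh s w))).re with hP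
  have hPcont : Continuous P :=
    Complex.continuous_re.comp ((birAct_continuous_action c hF sh).comp hext_c)
  have hcmp : ∀ δ, c₀ * ∑ s : TorusSite 2 L × ZMod M,
      ((1 - Real.cos (ext δ s - ext δ (s + (![1, 0], 0))))
        + (1 - Real.cos (ext δ s - ext δ (s + (![0, 1], 0))))
        + (1 - Real.cos (ext δ s - ext δ (s + (0, 1))))) ≤ P δ :=
    fun δ => birLat_coercive_compare hr hC hsh hc₀.le (ext δ)
  -- the nearest-neighbour quadratic form
  set P₂ : ({i // i ≠ s₀} → ℝ) → ℝ := fun δ => ∑ s : TorusSite 2 L × ZMod M,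
      ((ext δ s - ext δ (s + (![1, 0], 0))) ^ 2 + (ext δ s - ext δ (s + (![0, 1], 0))) ^ 2
        + (ext δ s - ext δ (s + (0, 1))) ^ 2) with hP₂
  have hP₂cont : Continuous P₂ := by
    refine continuous_finsetSum _ fun s _ => ?_
    exact ((((hext_ci _).sub (hext_ci _)).pow 2).add (((hext_ci _).sub (hext_ci _)).pow 2)).add
      (((hext_ci _).sub (hext_ci _)).pow 2)
  have hext_smul : ∀ (t : ℝ) δ i, ext (t • δ) i = t * ext δ i :=
    fun t δ i => birFixedVolume_ext_smul s₀ t δ i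
  have hhom : ∀ (t : ℝ) δ, P₂ (t • δ) = t ^ 2 * P₂ δ := by
    intro t δ
    simp only [hP₂, hext_smul, Finset.mul_sum]
    refine Finset.sum_congr rfl fun s _ => ?_
    ring
  have hP₂nn : ∀ δ, 0 ≤ P₂ δ := fun δ => Finset.sum_nonneg fun s _ => by positivity
  have hpos₂ : ∀ δ, δ ≠ 0 → 0 < P₂ δ := by
    intro δ hδ
    refine lt_of_le_of_ne (hP₂nn δ) fun h0 => hδ ?_
    have hterms := (Finset.sum_eq_zero_iff_of_nonneg (fun s _ => by positivity)).1 h0.symm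
    refine birLat_eq_zero_of_diff s₀ δ fun s v hv => ?_
    have hs := hterms s (Finset.mem_univ s)
    have h1 : ext δ s - ext δ (s + (![1, 0], 0)) = 0 := by nlinarith
    have h2 : ext δ s - ext δ (s + (![0, 1], 0)) = 0 := by nlinarith
    have h3 : ext δ s - ext δ (s + (0, 1)) = 0 := by nlinarith
    simp only [Set.mem_insert_iff, Set.mem_singleton_iff] at hv
    rcases hv with rfl | rfl | rfl
    · exact h1
    · exact h2
    · exact h3
  obtain ⟨lam₂, hlam₂, hquad⟩ := birCoercive_quadratic hP₂cont hhom hpos₂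
  -- local bound near the aligned configuration
  have hloc : ∀ δ : {i // i ≠ s₀} → ℝ, ‖δ‖ ≤ Real.pi / 2 →
      (c₀ * (2 / Real.pi ^ 2) * lam₂) * ∑ j, δ j ^ 2 ≤ P δ := by
    intro δ hδ
    have habs : ∀ i, |ext δ i| ≤ Real.pi / 2 := by
      refine birFixedVolume_abs_ext_le s₀ (by positivity) δ (fun j => ?_)
      have := norm_le_pi_norm δ j
      rw [Real.norm_eq_abs] at this
      exact this.trans hδ
    have hdiff : ∀ i i', |ext δ i - ext δ i'| ≤ Real.pi := by
      intro i i'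
      have := abs_sub (ext δ i) (ext δ i')
      linarith [habs i, habs i']
    have hJ : ∀ i i', 2 / Real.pi ^ 2 * (ext δ i - ext δ i') ^ 2
        ≤ 1 - Real.cos (ext δ i - ext δ i') :=
      fun i i' => birCoercive_one_sub_cos (hdiff i i')
    have hsum : 2 / Real.pi ^ 2 * P₂ δ ≤ ∑ s : TorusSite 2 L × ZMod M,
        ((1 - Real.cos (ext δ s - ext δ (s + (![1, 0], 0))))
          + (1 - Real.cos (ext δ s - ext δ (s + (![0, 1], 0))))
          + (1 - Real.cos (ext δ s - ext δ (s + (0, 1))))) := by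
      rw [hP₂, Finset.mul_sum]
      refine Finset.sum_le_sum fun s _ => ?_
      have := hJ s (s + (![1, 0], 0))
      have := hJ s (s + (![0, 1], 0))
      have := hJ s (s + (0, 1))
      linarith
    have h1 := hquad δ
    have h2 := hcmp δ
    have hc2 : 0 ≤ c₀ * (2 / Real.pi ^ 2) := by positivity
    calc c₀ * (2 / Real.pi ^ 2) * lam₂ * ∑ j, δ j ^ 2
        = c₀ * (2 / Real.pi ^ 2) * (lam₂ * ∑ j, δ j ^ 2) := by ring
      _ ≤ c₀ * (2 / Real.pi ^ 2) * P₂ δ := mul_le_mul_of_nonneg_left h1 hc2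
      _ = c₀ * (2 / Real.pi ^ 2 * P₂ δ) := by ring
      _ ≤ c₀ * ∑ s : TorusSite 2 L × ZMod M,
          ((1 - Real.cos (ext δ s - ext δ (s + (![1, 0], 0))))
            + (1 - Real.cos (ext δ s - ext δ (s + (![0, 1], 0))))
            + (1 - Real.cos (ext δ s - ext δ (s + (0, 1))))) :=
          mul_le_mul_of_nonneg_left hsum hc₀.le
      _ ≤ P δ := h2
  -- the zero set on the closed cube
  have hzero : ∀ δ ∈ Set.pi univ (fun _ : {i // i ≠ s₀} => Icc (-Real.pi) Real.pi),
      P δ ≤ 0 → δ = 0 := by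
    intro δ hδ hP0
    have hcos1 : ∀ x : ℝ, 0 ≤ 1 - Real.cos x := fun x => by linarith [Real.cos_le_one x]
    have hS0 : ∑ s : TorusSite 2 L × ZMod M,
        ((1 - Real.cos (ext δ s - ext δ (s + (![1, 0], 0))))
          + (1 - Real.cos (ext δ s - ext δ (s + (![0, 1], 0))))
          + (1 - Real.cos (ext δ s - ext δ (s + (0, 1))))) = 0 := by
      refine le_antisymm ?_ (Finset.sum_nonneg fun s _ => by
        linarith [hcos1 (ext δ s - ext δ (s + (![1, 0], 0))),
          hcos1 (ext δ s - ext δ (s + (![0, 1], 0))), hcos1 (ext δ s - ext δ (s + (0, 1)))])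
      have := hcmp δ
      by_contra hgt
      push Not at hgt
      have : 0 < c₀ * ∑ s : TorusSite 2 L × ZMod M,
          ((1 - Real.cos (ext δ s - ext δ (s + (![1, 0], 0))))
            + (1 - Real.cos (ext δ s - ext δ (s + (![0, 1], 0))))
            + (1 - Real.cos (ext δ s - ext δ (s + (0, 1))))) := mul_pos hc₀ hgt
      linarith
    have hterms := (Finset.sum_eq_zero_iff_of_nonneg (fun s _ => by
      linarith [hcos1 (ext δ s - ext δ (s + (![1, 0], 0))),
        hcos1 (ext δ s - ext δ (s + (![0, 1], 0))), hcos1 (ext δ s - ext δ (s + (0, 1)))])).1 hS0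
    have hδπ : ∀ j, |δ j| ≤ Real.pi := by
      intro j
      rw [Set.mem_univ_pi] at hδ
      exact abs_le.2 ⟨(hδ j).1, (hδ j).2⟩
    refine birLat_eq_zero_of_cos s₀ δ hδπ fun s v hv => ?_
    have hs := hterms s (Finset.mem_univ s)
    have e1 := hcos1 (ext δ s - ext δ (s + (![1, 0], 0)))
    have e2 := hcos1 (ext δ s - ext δ (s + (![0, 1], 0)))
    have e3 := hcos1 (ext δ s - ext δ (s + (0, 1)))
    simp only [Set.mem_insert_iff, Set.mem_singleton_iff] at hv
    rcases hv with rfl | rfl | rfl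
    · show Real.cos (ext δ s - ext δ (s + (![1, 0], 0))) = 1; linarith
    · show Real.cos (ext δ s - ext δ (s + (![0, 1], 0))) = 1; linarith
    · show Real.cos (ext δ s - ext δ (s + (0, 1))) = 1; linarith
  obtain ⟨m, hm, hmain⟩ := birCoercive_of_local hPcont (R := Real.pi) (ρ := Real.pi / 2)
    (by positivity) (by positivity) hzero hloc
  exact ⟨m, hm, hmain⟩

/-- `u ≠ 0` has a positive sum of squares. -/
theorem birFixedVolume_sum_sq_pos {J : Type*} [Fintype J] {u : J → ℝ} (hu : u ≠ 0) :
    0 < ∑ j, u j ^ 2 := by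
  by_contra h
  push Not at h
  apply hu
  have h0 : ∑ j, u j ^ 2 = 0 := le_antisymm h (Finset.sum_nonneg fun j _ => sq_nonneg _)
  have := (Finset.sum_eq_zero_iff_of_nonneg fun j _ => sq_nonneg (u j)).1 h0
  funext j
  have hj := this j (Finset.mem_univ j)
  simpa using hj


end FixedVolume

end Summit.HubbardSuperconductivity.HubbardSuperconductivity.Theorems
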